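import Mathlib

/-!
# Crux `ExactCertificate` (stmt-AtomisticToContinuum-11959), line `closure-makes-nogap-exact`,
# skeleton IX (`FarSlackActive`): stub `stub_remEntire` (F4)

Support file for the crux `ThreeConeCertificate.ExactCertificate`, skeleton IX
(`Cruxes.ExactCertificate.FarEqual`: the slack cone of an exact three-cone certificate is active
beyond every radius).  Skeleton IX shows that the cosine transform of a power tail
`∫_ρ^∞ x^{-(2n+2)} cos (σ x) dx` is, for `σ > 0`, the restriction of an entire function of
exponential type, by writing `cos = T_n + R_n` (Taylor polynomial plus remainder).  This file
supplies the COMPACT piece: given the Taylor-remainder facts of stub F3 (taken here as the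
hypothesis `hF3`, proved elsewhere), the function

  `R z := ∫_{(0, ρ]} x^{-(2n+2)} (cos (z x) − T_n(z x)) dx`

is entire of exponential type, and for real `σ` it is literally the required integral.

The analysis is done for an abstract remainder `C : ℂ → ℂ` with derivative `D`
(`C := cos − T_n`, `D := −(sin − S_n)`), assuming only the F3-type bounds
`‖C y‖ ≤ ‖y‖^{2n+2} e^{‖y‖}/(2n+2)!`, `‖D y‖ ≤ ‖y‖^{2n+1} e^{‖y‖}/(2n+1)!`, `C' = D`:

* on `(0, ρ]` the integrand `x^{-N} C(z x)` (`N := 2n+2`) is bounded by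
  `x^{-N} (‖z‖ x)^N e^{‖z‖ x}/N! = (‖z‖^N/N!) e^{‖z‖ x} ≤ e^{‖z‖} e^{ρ ‖z‖} = e^{(ρ+1)‖z‖}`
  (`Real.pow_div_factorial_le_exp`): no singularity at `0`;
* its `z`-derivative `x^{-N} D(z x) x` is bounded the same way by `e^{(ρ+1)‖z‖}`, uniformly on
  the ball `B(z₀, 1)`; differentiation under the integral sign
  (`hasDerivAt_integral_of_dominated_loc_of_deriv_le` on the finite measure
  `volume.restrict (Ioc 0 ρ)`, constant dominating function) makes `R` entire;
* `‖R z‖ ≤ ρ e^{(ρ+1)‖z‖}` (`norm_setIntegral_le_of_norm_le_const`, `volume (Ioc 0 ρ) = ρ`).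

Pure Mathlib; private helper lemmas only, no definitions, no named facts.  All `[folklore]`.
-/

noncomputable section

namespace Summit.AtomisticToContinuum.Crystallization.Theorems.ThreeConeCertificateExactCertificate.FarEqual

open MeasureTheory Set
open scoped BigOperators

/-- `‖z x‖ = ‖z‖ x` for a complex `z` and a real `x > 0`. [folklore] -/
private theorem norm_mul_ofReal_of_pos (z : ℂ) {x : ℝ} (hx : 0 < x) :
    ‖z * (x : ℂ)‖ = ‖z‖ * x := by
  rw [norm_mul, Complex.norm_real, Real.norm_eq_abs, abs_of_pos hx]

/-- Bound on the remainder integrand on `(0, ρ]`: if `‖C y‖ ≤ ‖y‖^{2n+2} e^{‖y‖}/(2n+2)!` then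
`‖x^{-(2n+2)} C(z x)‖ ≤ e^{(ρ+1)‖z‖}` for `0 < x ≤ ρ` (`‖z‖^N/N! ≤ e^{‖z‖}`). [folklore] -/
private theorem norm_integrand_le {n : ℕ} {C : ℂ → ℂ}
    (hC : ∀ y : ℂ, ‖C y‖ ≤ ‖y‖ ^ (2 * n + 2) * Real.exp ‖y‖ / ((2 * n + 2).factorial : ℝ))
    {ρ : ℝ} (z : ℂ) {x : ℝ} (hx : x ∈ Ioc 0 ρ) :
    ‖(((x ^ (2 * n + 2))⁻¹ : ℝ) : ℂ) * C (z * x)‖ ≤ Real.exp ((ρ + 1) * ‖z‖) := by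
  obtain ⟨hx0, hxρ⟩ := hx
  have hxN : 0 < x ^ (2 * n + 2) := pow_pos hx0 _
  have hxN' : x ^ (2 * n + 2) ≠ 0 := hxN.ne'
  have h1 : ‖(((x ^ (2 * n + 2))⁻¹ : ℝ) : ℂ) * C (z * x)‖ ≤ (x ^ (2 * n + 2))⁻¹ *
      ((‖z‖ * x) ^ (2 * n + 2) * Real.exp (‖z‖ * x) / ((2 * n + 2).factorial : ℝ)) := by
    rw [norm_mul, Complex.norm_real, Real.norm_eq_abs, abs_of_pos (inv_pos.2 hxN),
      ← norm_mul_ofReal_of_pos z hx0]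
    exact mul_le_mul_of_nonneg_left (hC _) (inv_pos.2 hxN).le
  have h2 : (x ^ (2 * n + 2))⁻¹ *
      ((‖z‖ * x) ^ (2 * n + 2) * Real.exp (‖z‖ * x) / ((2 * n + 2).factorial : ℝ)) =
      ‖z‖ ^ (2 * n + 2) / ((2 * n + 2).factorial : ℝ) * Real.exp (‖z‖ * x) := by
    rw [mul_pow]
    field_simp
  have h3 : ‖z‖ ^ (2 * n + 2) / ((2 * n + 2).factorial : ℝ) ≤ Real.exp ‖z‖ :=
    Real.pow_div_factorial_le_exp ‖z‖ (norm_nonneg z) _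
  have h4 : Real.exp (‖z‖ * x) ≤ Real.exp (‖z‖ * ρ) :=
    Real.exp_le_exp.2 (mul_le_mul_of_nonneg_left hxρ (norm_nonneg z))
  calc ‖(((x ^ (2 * n + 2))⁻¹ : ℝ) : ℂ) * C (z * x)‖
      ≤ ‖z‖ ^ (2 * n + 2) / ((2 * n + 2).factorial : ℝ) * Real.exp (‖z‖ * x) := h1.trans_eq h2
    _ ≤ Real.exp ‖z‖ * Real.exp (‖z‖ * ρ) :=
        mul_le_mul h3 h4 (Real.exp_pos _).le (Real.exp_pos _).le
    _ = Real.exp ((ρ + 1) * ‖z‖) := by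
        rw [← Real.exp_add]
        congr 1
        ring

/-- Bound on the `z`-derivative of the remainder integrand on `(0, ρ]`: if
`‖D y‖ ≤ ‖y‖^{2n+1} e^{‖y‖}/(2n+1)!` then `‖x^{-(2n+2)} D(z x) x‖ ≤ e^{(ρ+1)‖z‖}` for `0 < x ≤ ρ`.
[folklore] -/
private theorem norm_integrand_deriv_le {n : ℕ} {D : ℂ → ℂ}
    (hD : ∀ y : ℂ, ‖D y‖ ≤ ‖y‖ ^ (2 * n + 1) * Real.exp ‖y‖ / ((2 * n + 1).factorial : ℝ))
    {ρ : ℝ} (z : ℂ) {x : ℝ} (hx : x ∈ Ioc 0 ρ) :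
    ‖(((x ^ (2 * n + 2))⁻¹ : ℝ) : ℂ) * (D (z * x) * (x : ℂ))‖ ≤ Real.exp ((ρ + 1) * ‖z‖) := by
  obtain ⟨hx0, hxρ⟩ := hx
  have hxN : 0 < x ^ (2 * n + 2) := pow_pos hx0 _
  have hxN' : x ^ (2 * n + 2) ≠ 0 := hxN.ne'
  have h1 : ‖(((x ^ (2 * n + 2))⁻¹ : ℝ) : ℂ) * (D (z * x) * (x : ℂ))‖ ≤ (x ^ (2 * n + 2))⁻¹ *
      ((‖z‖ * x) ^ (2 * n + 1) * Real.exp (‖z‖ * x) / ((2 * n + 1).factorial : ℝ) * x) := by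
    rw [norm_mul, norm_mul, Complex.norm_real, Complex.norm_real, Real.norm_eq_abs,
      Real.norm_eq_abs, abs_of_pos (inv_pos.2 hxN), abs_of_pos hx0,
      ← norm_mul_ofReal_of_pos z hx0]
    exact mul_le_mul_of_nonneg_left (mul_le_mul_of_nonneg_right (hD _) hx0.le)
      (inv_pos.2 hxN).le
  have h2 : (x ^ (2 * n + 2))⁻¹ *
      ((‖z‖ * x) ^ (2 * n + 1) * Real.exp (‖z‖ * x) / ((2 * n + 1).factorial : ℝ) * x) =
      ‖z‖ ^ (2 * n + 1) / ((2 * n + 1).factorial : ℝ) * Real.exp (‖z‖ * x) := by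
    rw [mul_pow]
    field_simp
    ring
  have h3 : ‖z‖ ^ (2 * n + 1) / ((2 * n + 1).factorial : ℝ) ≤ Real.exp ‖z‖ :=
    Real.pow_div_factorial_le_exp ‖z‖ (norm_nonneg z) _
  have h4 : Real.exp (‖z‖ * x) ≤ Real.exp (‖z‖ * ρ) :=
    Real.exp_le_exp.2 (mul_le_mul_of_nonneg_left hxρ (norm_nonneg z))
  calc ‖(((x ^ (2 * n + 2))⁻¹ : ℝ) : ℂ) * (D (z * x) * (x : ℂ))‖
      ≤ ‖z‖ ^ (2 * n + 1) / ((2 * n + 1).factorial : ℝ) * Real.exp (‖z‖ * x) := h1.trans_eq h2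
    _ ≤ Real.exp ‖z‖ * Real.exp (‖z‖ * ρ) :=
        mul_le_mul h3 h4 (Real.exp_pos _).le (Real.exp_pos _).le
    _ = Real.exp ((ρ + 1) * ‖z‖) := by
        rw [← Real.exp_add]
        congr 1
        ring

/-- The remainder integrand `x ↦ x^{-m} C(z x)` is measurable for continuous `C` (a measurable
power times a continuous function). [folklore] -/
private theorem measurable_integrand {m : ℕ} {C : ℂ → ℂ} (hC : Continuous C) (z : ℂ) :
    Measurable fun x : ℝ => (((x ^ m)⁻¹ : ℝ) : ℂ) * C (z * x) := by
  have hCm : Measurable C := hC.measurable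
  fun_prop

/-- The `z`-derivative `x ↦ x^{-m} D(z x) x` of the remainder integrand is measurable for
continuous `D`. [folklore] -/
private theorem measurable_integrand_deriv {m : ℕ} {D : ℂ → ℂ} (hD : Continuous D) (z : ℂ) :
    Measurable fun x : ℝ => (((x ^ m)⁻¹ : ℝ) : ℂ) * (D (z * x) * (x : ℂ)) := by
  have hDm : Measurable D := hD.measurable
  fun_prop

/-- Pointwise derivative in `z` of the remainder integrand: `C' = D` composed with `z ↦ z x`
(`HasDerivAt.comp`, `hasDerivAt_mul_const`) times the constant `x^{-m}`. [folklore] -/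
private theorem hasDerivAt_integrand {m : ℕ} {C D : ℂ → ℂ} (hCD : ∀ y : ℂ, HasDerivAt C (D y) y)
    (x : ℝ) (z : ℂ) :
    HasDerivAt (fun w : ℂ => (((x ^ m)⁻¹ : ℝ) : ℂ) * C (w * x))
      ((((x ^ m)⁻¹ : ℝ) : ℂ) * (D (z * x) * (x : ℂ))) z :=
  ((hCD (z * x)).comp z (hasDerivAt_mul_const (x : ℂ))).const_mul _

/-- Differentiation under the integral sign on the finite measure `volume.restrict (Ioc 0 ρ)`:
`z ↦ ∫_{(0, ρ]} x^{-(2n+2)} C(z x) dx` is complex-differentiable at every `z₀`, with derivative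
`∫_{(0, ρ]} x^{-(2n+2)} D(z₀ x) x dx` (`hasDerivAt_integral_of_dominated_loc_of_deriv_le` on the
ball `B(z₀, 1)` with the constant dominating function `e^{(ρ+1)(‖z₀‖+1)}`). [folklore] -/
private theorem hasDerivAt_remIntegral {n : ℕ} {C D : ℂ → ℂ} {ρ : ℝ}
    (hC : ∀ y : ℂ, ‖C y‖ ≤ ‖y‖ ^ (2 * n + 2) * Real.exp ‖y‖ / ((2 * n + 2).factorial : ℝ))
    (hD : ∀ y : ℂ, ‖D y‖ ≤ ‖y‖ ^ (2 * n + 1) * Real.exp ‖y‖ / ((2 * n + 1).factorial : ℝ))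
    (hCD : ∀ y : ℂ, HasDerivAt C (D y) y) (hDc : Continuous D) (z₀ : ℂ) :
    HasDerivAt (fun z : ℂ => ∫ x in Ioc 0 ρ, (((x ^ (2 * n + 2))⁻¹ : ℝ) : ℂ) * C (z * x))
      (∫ x in Ioc 0 ρ, (((x ^ (2 * n + 2))⁻¹ : ℝ) : ℂ) * (D (z₀ * x) * (x : ℂ))) z₀ := by
  have hCc : Continuous C := continuous_iff_continuousAt.2 fun y => (hCD y).continuousAt
  have key := hasDerivAt_integral_of_dominated_loc_of_deriv_le
    (μ := volume.restrict (Ioc 0 ρ)) (𝕜 := ℂ)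
    (F := fun (z : ℂ) (x : ℝ) => (((x ^ (2 * n + 2))⁻¹ : ℝ) : ℂ) * C (z * x))
    (F' := fun (z : ℂ) (x : ℝ) => (((x ^ (2 * n + 2))⁻¹ : ℝ) : ℂ) * (D (z * x) * (x : ℂ)))
    (x₀ := z₀) (s := Metric.ball z₀ 1) (bound := fun _ => Real.exp ((ρ + 1) * (‖z₀‖ + 1)))
    (Metric.ball_mem_nhds z₀ one_pos) ?_ ?_ ?_ ?_ ?_ ?_
  · exact key.2
  · exact Filter.Eventually.of_forall fun z => (measurable_integrand hCc z).aestronglyMeasurable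
  · exact Integrable.mono' (integrable_const _) (measurable_integrand hCc z₀).aestronglyMeasurable
      ((ae_restrict_iff' measurableSet_Ioc).2 (ae_of_all _ fun x hx => norm_integrand_le hC z₀ hx))
  · exact (measurable_integrand_deriv hDc z₀).aestronglyMeasurable
  · refine (ae_restrict_iff' measurableSet_Ioc).2 (ae_of_all _ fun x hx z hz => ?_)
    refine (norm_integrand_deriv_le hD z hx).trans (Real.exp_le_exp.2 ?_)
    have hz' : ‖z‖ ≤ ‖z₀‖ + 1 := by
      rw [Metric.mem_ball, dist_eq_norm] at hz
      calc ‖z‖ = ‖(z - z₀) + z₀‖ := by rw [sub_add_cancel]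
        _ ≤ ‖z - z₀‖ + ‖z₀‖ := norm_add_le _ _
        _ ≤ ‖z₀‖ + 1 := by linarith
    have hρ1 : 0 ≤ ρ + 1 := by linarith [hx.1, hx.2]
    exact mul_le_mul_of_nonneg_left hz' hρ1
  · exact integrable_const _
  · exact ae_of_all _ fun x z _ => hasDerivAt_integrand hCD x z

/-- Exponential type: `‖∫_{(0, ρ]} x^{-(2n+2)} C(z x) dx‖ ≤ ρ e^{(ρ+1)‖z‖}` (constant bound on a
set of measure `ρ`). [folklore] -/
private theorem norm_remIntegral_le {n : ℕ} {C : ℂ → ℂ} {ρ : ℝ} (hρ : 0 < ρ)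
    (hC : ∀ y : ℂ, ‖C y‖ ≤ ‖y‖ ^ (2 * n + 2) * Real.exp ‖y‖ / ((2 * n + 2).factorial : ℝ))
    (z : ℂ) :
    ‖∫ x in Ioc 0 ρ, (((x ^ (2 * n + 2))⁻¹ : ℝ) : ℂ) * C (z * x)‖ ≤
      ρ * Real.exp ((ρ + 1) * ‖z‖) := by
  have h := norm_setIntegral_le_of_norm_le_const (μ := volume) (s := Ioc 0 ρ)
    (f := fun x : ℝ => (((x ^ (2 * n + 2))⁻¹ : ℝ) : ℂ) * C (z * x))
    measure_Ioc_lt_top (fun x hx => norm_integrand_le hC z hx)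
  rw [Real.volume_real_Ioc_of_le hρ.le, sub_zero] at h
  exact h.trans_eq (mul_comm _ _)

/-- **Stub F4 (the compact remainder is entire).**  Given the Taylor-remainder facts of stub F3
(`‖cos y − T_n y‖ ≤ ‖y‖^{2n+2}e^{‖y‖}/(2n+2)!`, the sine analogue, `(cos − T_n)' = −(sin − S_n)`),
for every `n` and `ρ > 0` the function `σ ↦ ∫_0^ρ x^{−(2n+2)}(cos(σx) − T_n(σx))dx` is the
restriction to `ℝ` of an entire function `R z := ∫_{(0, ρ]} x^{−(2n+2)}(cos(zx) − T_n(zx))dx` of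
exponential type, `‖R z‖ ≤ ρ e^{(ρ+1)‖z‖}` (dominated differentiation on `(0, ρ]`; the integrand
and its `z`-derivative are bounded by `e^{(ρ+1)‖z‖}`). [folklore] -/
theorem stub_remEntire : (∀ (n : ℕ) (y : ℂ),
      ‖Complex.cos y - ∑ k ∈ Finset.range (n + 1), (-1 : ℂ) ^ k * y ^ (2 * k) / ((2 * k).factorial : ℂ)‖ ≤
          ‖y‖ ^ (2 * n + 2) * Real.exp ‖y‖ / ((2 * n + 2).factorial : ℝ) ∧
        ‖Complex.sin y - ∑ k ∈ Finset.range n, (-1 : ℂ) ^ k * y ^ (2 * k + 1) / ((2 * k + 1).factorial : ℂ)‖ ≤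
          ‖y‖ ^ (2 * n + 1) * Real.exp ‖y‖ / ((2 * n + 1).factorial : ℝ) ∧
        HasDerivAt (fun w : ℂ => Complex.cos w - ∑ k ∈ Finset.range (n + 1), (-1 : ℂ) ^ k * w ^ (2 * k) / ((2 * k).factorial : ℂ))
          (-(Complex.sin y - ∑ k ∈ Finset.range n, (-1 : ℂ) ^ k * y ^ (2 * k + 1) / ((2 * k + 1).factorial : ℂ))) y) →
    ∀ (n : ℕ) (ρ : ℝ), 0 < ρ → ∃ R : ℂ → ℂ, Differentiable ℂ R ∧
        (∃ B τ : ℝ, ∀ z : ℂ, ‖R z‖ ≤ B * Real.exp (τ * ‖z‖)) ∧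
        ∀ σ : ℝ, R (σ : ℂ) = ∫ x in Set.Ioc 0 ρ,
          (((x ^ (2 * n + 2))⁻¹ : ℝ) : ℂ) * (Complex.cos ((σ : ℂ) * x) - ∑ k ∈ Finset.range (n + 1), (-1 : ℂ) ^ k * ((σ : ℂ) * x) ^ (2 * k) / ((2 * k).factorial : ℂ)) := by
  intro hF3 n ρ hρ
  -- `C := cos − T_n`, `D := −(sin − S_n)`; F3 supplies the bounds and `C' = D`.
  have hC : ∀ y : ℂ, ‖Complex.cos y - ∑ k ∈ Finset.range (n + 1),
      (-1 : ℂ) ^ k * y ^ (2 * k) / ((2 * k).factorial : ℂ)‖ ≤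
      ‖y‖ ^ (2 * n + 2) * Real.exp ‖y‖ / ((2 * n + 2).factorial : ℝ) := fun y => (hF3 n y).1
  have hD : ∀ y : ℂ, ‖-(Complex.sin y - ∑ k ∈ Finset.range n,
      (-1 : ℂ) ^ k * y ^ (2 * k + 1) / ((2 * k + 1).factorial : ℂ))‖ ≤
      ‖y‖ ^ (2 * n + 1) * Real.exp ‖y‖ / ((2 * n + 1).factorial : ℝ) := fun y => by
    rw [norm_neg]
    exact (hF3 n y).2.1
  have hCD := fun y => (hF3 n y).2.2
  have hDc : Continuous fun y : ℂ => -(Complex.sin y - ∑ k ∈ Finset.range n,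
      (-1 : ℂ) ^ k * y ^ (2 * k + 1) / ((2 * k + 1).factorial : ℂ)) := by
    fun_prop
  refine ⟨fun z : ℂ => ∫ x in Ioc 0 ρ, (((x ^ (2 * n + 2))⁻¹ : ℝ) : ℂ) *
      (Complex.cos (z * x) - ∑ k ∈ Finset.range (n + 1),
        (-1 : ℂ) ^ k * (z * x) ^ (2 * k) / ((2 * k).factorial : ℂ)), ?_, ⟨ρ, ρ + 1, fun z => ?_⟩,
    fun σ => rfl⟩
  · -- entire: differentiate under the integral sign at every point
    exact fun z => (hasDerivAt_remIntegral (D := fun y : ℂ => -(Complex.sin y -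
      ∑ k ∈ Finset.range n, (-1 : ℂ) ^ k * y ^ (2 * k + 1) / ((2 * k + 1).factorial : ℂ)))
      hC hD hCD hDc z).differentiableAt
  · -- exponential type `‖R z‖ ≤ ρ e^{(ρ+1)‖z‖}`
    exact norm_remIntegral_le hρ hC z

end Summit.AtomisticToContinuum.Crystallization.Theorems.ThreeConeCertificateExactCertificate.FarEqual
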